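import Literature.Analysis.Calculus.WhitneyConvexPartition
import Mathlib.Topology.Algebra.InfiniteSum.Real
import Mathlib.Analysis.Calculus.ContDiff.Basic
import HarnessLib

/-!
# Route `PrimeLevelFamEdge`, crux K_B (stmt-Parity-20343), line `diagonal_kernel_split` rev 4,
# plan Ω, sub-line **Ω-d4 — smooth dyadic partition of the `(n₁, n₂)`-sum of `offDiag` into boxes,
# and the smooth compactly supported box weights `Φ = θ(y₁/K₁)θ(y₂/K₂)·g(y₁,y₂)` that Poisson summation consumes**

Poisson summation modulo `c` (sub-line Ω-d1, `OffDiagPoissonTwisted`, built on the tree's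
`FriedlanderIwaniecPrimes.tsum_arithProg_eq_tsum_fourier` / `tsum_tsum_arithProg₂`) wants a smooth,
compactly supported function on `ℝ²`; the summand of `PeterssonSplit.offDiag` —
`k ↦ w_q(d₁k₁,d₂k₂)·r⁻¹S(αk₁,βk₂;qr)J₁(4π√(αβk₁k₂)/(qr))` — is smooth only on the open quadrant and
decays but is not compactly supported. The standard cure (GATE G2 §(a) row a5: «dyadic `N₁N₂`-boxes») is a
smooth dyadic partition of unity. This file supplies it, from the tree's dyadic bump
`θ = WhitneyConvex.dyadicBump` (smooth, `0 ≤ θ ≤ 1`, `θ = 0` off `(1/2, 2)`, telescoping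
`WhitneyConvex.sum_range_dyadicBump`):

* §1 `sum_range_dyadicBump_div_two_pow`, **`hasSum_dyadicBump_div_two_pow`** — for `y ≥ 1`,
  `Σ_{i ∈ ℕ} θ(y/2^i) = 1` (finitely many non-zero terms: `2^{i−1} < y < 2^{i+1}`), and `= 0` at `y = 0`;
* §2 **`tsum_eq_tsum_dyadicBoxes`** — for an absolutely convergent `a : ℕ × ℕ → ℂ` vanishing on the axes,
  `Σ_k a(k) = Σ_{(i₁,i₂) ∈ ℕ²} Σ_k θ(k₁/2^{i₁})θ(k₂/2^{i₂})·a(k)`, each inner sum FINITE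
  (`tsum_dyadicBox_eq_sum`: supported in `k_j ≤ 2^{i_j+1}`), the outer series absolutely convergent
  (`summable_dyadicBoxes`);
* §3 **`contDiff_dyadicBox_mul`**, **`hasCompactSupport_dyadicBox_mul`** — for `g` smooth on the open
  quadrant `(0,∞)²` and `K₁, K₂ > 0`, the box weight `Φ(y) = θ(y₁/K₁)θ(y₂/K₂)·g(y)` (extended by the same
  formula everywhere) is `C^∞` on `ℝ²` with support in `[K₁/2, 2K₁] × [K₂/2, 2K₂]`.

Pure real analysis; theorems only; standard axioms. Helper toward the heart `stub_offDiagBelowSlack_io`; closes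
nothing. «The programme SEARCHES and TYPES; no claim about Landau–Siegel zeros, Theorems 1–2 of arXiv:2211.02515
or a repaired Margin232 until a kernel theorem says so.»
-/

noncomputable section

open Finset Filter Set
open scoped Topology ContDiff

namespace Summit.Parity.GeneralizedHardyLittlewood.Theorems.BeyondDiagonalBeatsQuarter.OffDiag

open Literature.Analysis.Calculus.WhitneyConvex

/-! ### §1 The dyadic partition of unity on `[1, ∞)` -/

/-- `θ(y/2^i) = 0` unless `2^{i−1} < y`, i.e. it vanishes once `y ≤ 2^i/2`. [folklore] -/
theorem dyadicBump_div_two_pow_eq_zero_of_le {y : ℝ} {i : ℕ} (h : y ≤ 2 ^ i / 2) :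
    dyadicBump (y / 2 ^ i) = 0 :=
  dyadicBump_of_le_half (by rw [div_le_iff₀ (by positivity)]; linarith)

/-- `θ(y/2^i) = 0` once `2^{i+1} ≤ y`. [folklore] -/
theorem dyadicBump_div_two_pow_eq_zero_of_ge {y : ℝ} {i : ℕ} (h : 2 ^ (i + 1) ≤ y) :
    dyadicBump (y / 2 ^ i) = 0 :=
  dyadicBump_of_two_le (by rw [le_div_iff₀ (by positivity), pow_succ] at *; linarith)

/-- If `θ(y/2^i) ≠ 0` then `2^i/2 < y < 2^{i+1}`. [folklore] -/
theorem mem_Ioo_of_dyadicBump_div_two_pow_ne_zero {y : ℝ} {i : ℕ} (h : dyadicBump (y / 2 ^ i) ≠ 0) :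
    2 ^ i / 2 < y ∧ y < 2 ^ (i + 1) :=
  ⟨lt_of_not_ge fun h' ↦ h (dyadicBump_div_two_pow_eq_zero_of_le h'),
    lt_of_not_ge fun h' ↦ h (dyadicBump_div_two_pow_eq_zero_of_ge h')⟩

/-- For `y < 2^N` the terms `i ≥ N + 1`... precisely: if `y < 2^i / 2 · 2 = 2^i`, i.e. `i` with `2^i/2 ≥ y`,
vanish; a convenient form: for `i ∉ range N` and `y ≤ 2^N / 2`, `θ(y/2^i) = 0`. [folklore] -/
theorem dyadicBump_div_two_pow_eq_zero_of_not_mem_range {y : ℝ} {N i : ℕ} (hy : y ≤ 2 ^ N / 2)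
    (hi : i ∉ Finset.range N) : dyadicBump (y / 2 ^ i) = 0 := by
  refine dyadicBump_div_two_pow_eq_zero_of_le (hy.trans ?_)
  rw [Finset.mem_range, not_lt] at hi
  exact div_le_div_of_nonneg_right (pow_le_pow_right₀ (by norm_num) hi) (by norm_num)

/-- **Finite dyadic partition**: for `1 ≤ y ≤ 2^N/2`, `Σ_{i<N} θ(y/2^i) = 1` (the tree's telescoping identity
`Σ_{k<N} θ(2^k s) = χ(s) − χ(2^N s)` at `s = 2y/2^N`, read backwards). [folklore] -/
theorem sum_range_dyadicBump_div_two_pow {y : ℝ} {N : ℕ} (hy1 : 1 ≤ y) (hyN : y ≤ 2 ^ N / 2) :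
    ∑ i ∈ Finset.range N, dyadicBump (y / 2 ^ i) = 1 := by
  have hN : N ≠ 0 := by
    rintro rfl
    norm_num at hyN
    linarith
  -- telescoping at `s = 2y/2^N`
  have htel := sum_range_dyadicBump (2 * y / 2 ^ N) N
  have h2N : (2 : ℝ) ^ N * (2 * y / 2 ^ N) = 2 * y := by field_simp
  rw [h2N, dyadicCutoff_of_two_le (show (2 : ℝ) ≤ 2 * y by linarith), sub_zero,
    dyadicCutoff_of_le_one (show 2 * y / 2 ^ N ≤ 1 by
      rw [div_le_one (by positivity)]; linarith)] at htel
  rw [← htel, ← Finset.sum_range_reflect]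
  refine Finset.sum_congr rfl fun i hi ↦ ?_
  rw [Finset.mem_range] at hi
  congr 1
  have hpow : (2 : ℝ) ^ N = 2 ^ (N - 1 - i) * 2 ^ i * 2 := by
    rw [← pow_add, ← pow_succ]
    congr 1
    omega
  rw [hpow]
  field_simp

/-- **The dyadic partition of unity on `[1, ∞)`**: for `y ≥ 1`, `Σ_{i ∈ ℕ} θ(y/2^i) = 1` (a finite sum in
disguise). [folklore] -/
theorem hasSum_dyadicBump_div_two_pow {y : ℝ} (hy : 1 ≤ y) :
    HasSum (fun i : ℕ ↦ dyadicBump (y / 2 ^ i)) 1 := by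
  -- choose `N` with `y ≤ 2^N / 2`
  obtain ⟨N, hN⟩ : ∃ N : ℕ, y ≤ 2 ^ N / 2 := by
    obtain ⟨n, hn⟩ := pow_unbounded_of_one_lt (2 * y) (by norm_num : (1 : ℝ) < 2)
    exact ⟨n, by linarith⟩
  have h : HasSum (fun i : ℕ ↦ dyadicBump (y / 2 ^ i)) (∑ i ∈ Finset.range N, dyadicBump (y / 2 ^ i)) :=
    hasSum_sum_of_ne_finset_zero fun i hi ↦ dyadicBump_div_two_pow_eq_zero_of_not_mem_range hN hi
  rwa [sum_range_dyadicBump_div_two_pow hy hN] at h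

/-- The partition sums to `1` at every `y ≥ 1`. [folklore] -/
theorem tsum_dyadicBump_div_two_pow {y : ℝ} (hy : 1 ≤ y) : ∑' i : ℕ, dyadicBump (y / 2 ^ i) = 1 :=
  (hasSum_dyadicBump_div_two_pow hy).tsum_eq

/-- At `y = 0` every term vanishes. [folklore] -/
theorem dyadicBump_zero_div (i : ℕ) : dyadicBump ((0 : ℝ) / 2 ^ i) = 0 := by
  rw [zero_div]; exact dyadicBump_of_le_half (by norm_num)

/-- The terms are summable for every `y ≥ 0`... in fact for every natural number `k` (value `1` if `k ≥ 1`,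
`0` if `k = 0`). [folklore] -/
theorem hasSum_dyadicBump_natCast_div (k : ℕ) :
    HasSum (fun i : ℕ ↦ dyadicBump ((k : ℝ) / 2 ^ i)) (if k = 0 then 0 else 1) := by
  split_ifs with hk
  · subst hk
    simp only [Nat.cast_zero, dyadicBump_zero_div]
    exact hasSum_zero
  · exact hasSum_dyadicBump_div_two_pow (by exact_mod_cast Nat.one_le_iff_ne_zero.mpr hk)

/-! ### §2 Inserting the partition into an absolutely convergent double series -/

/-- The two-dimensional dyadic weight of box `i = (i₁, i₂)` at `k = (k₁, k₂)`:
`θ(k₁/2^{i₁})·θ(k₂/2^{i₂})`, written inline. It lies in `[0, 1]`. [folklore] -/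
theorem dyadicWeight_mem_Icc (i k : ℕ × ℕ) :
    dyadicBump ((k.1 : ℝ) / 2 ^ i.1) * dyadicBump ((k.2 : ℝ) / 2 ^ i.2) ∈ Set.Icc (0 : ℝ) 1 :=
  ⟨mul_nonneg (dyadicBump_nonneg _) (dyadicBump_nonneg _),
    mul_le_one₀ (dyadicBump_le_one _) (dyadicBump_nonneg _) (dyadicBump_le_one _)⟩

/-- For fixed `k` with `k₁, k₂ ≥ 1` the weights over all boxes sum to `1`; if `k₁ = 0` or `k₂ = 0` they sum to `0`.
[folklore] -/
theorem hasSum_dyadicWeight (k : ℕ × ℕ) :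
    HasSum (fun i : ℕ × ℕ ↦ dyadicBump ((k.1 : ℝ) / 2 ^ i.1) * dyadicBump ((k.2 : ℝ) / 2 ^ i.2))
      (if k.1 = 0 ∨ k.2 = 0 then 0 else 1) := by
  -- summability of the product family: finite support
  obtain ⟨N₁, hN₁⟩ : ∃ N : ℕ, (k.1 : ℝ) ≤ 2 ^ N / 2 := by
    obtain ⟨n, hn⟩ := pow_unbounded_of_one_lt (2 * (k.1 : ℝ)) (by norm_num : (1 : ℝ) < 2)
    exact ⟨n, by linarith⟩
  obtain ⟨N₂, hN₂⟩ : ∃ N : ℕ, (k.2 : ℝ) ≤ 2 ^ N / 2 := by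
    obtain ⟨n, hn⟩ := pow_unbounded_of_one_lt (2 * (k.2 : ℝ)) (by norm_num : (1 : ℝ) < 2)
    exact ⟨n, by linarith⟩
  have hsum : Summable (fun i : ℕ × ℕ ↦
      dyadicBump ((k.1 : ℝ) / 2 ^ i.1) * dyadicBump ((k.2 : ℝ) / 2 ^ i.2)) := by
    refine summable_of_ne_finset_zero (s := Finset.range N₁ ×ˢ Finset.range N₂) fun i hi ↦ ?_
    rw [Finset.mem_product, not_and_or] at hi
    rcases hi with hi | hi
    · rw [dyadicBump_div_two_pow_eq_zero_of_not_mem_range hN₁ hi, zero_mul]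
    · rw [dyadicBump_div_two_pow_eq_zero_of_not_mem_range hN₂ hi, mul_zero]
  have h := (hasSum_dyadicBump_natCast_div k.1).mul (hasSum_dyadicBump_natCast_div k.2) hsum
  have hv : (if k.1 = 0 ∨ k.2 = 0 then (0 : ℝ) else 1) =
      (if k.1 = 0 then (0 : ℝ) else 1) * (if k.2 = 0 then (0 : ℝ) else 1) := by
    by_cases h1 : k.1 = 0 <;> by_cases h2 : k.2 = 0 <;> simp [h1, h2]
  rw [hv]
  exact h

/-- The box-`i` piece of `a` is supported in `k_j < 2^{i_j+1}`: outside that finite box the weight vanishes.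
[folklore] -/
theorem dyadicWeight_eq_zero_of_not_mem_box {i k : ℕ × ℕ}
    (hk : k ∉ Finset.range (2 ^ (i.1 + 1)) ×ˢ Finset.range (2 ^ (i.2 + 1))) :
    dyadicBump ((k.1 : ℝ) / 2 ^ i.1) * dyadicBump ((k.2 : ℝ) / 2 ^ i.2) = 0 := by
  rw [Finset.mem_product, not_and_or, Finset.mem_range, Finset.mem_range, not_lt, not_lt] at hk
  rcases hk with hk | hk
  · rw [dyadicBump_div_two_pow_eq_zero_of_ge (y := (k.1 : ℝ)) (i := i.1) (by exact_mod_cast hk), zero_mul]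
  · rw [dyadicBump_div_two_pow_eq_zero_of_ge (y := (k.2 : ℝ)) (i := i.2) (by exact_mod_cast hk), mul_zero]

/-- **Each dyadic box piece is a finite sum**: `Σ'_k θθ·a(k) = Σ_{k₁ < 2^{i₁+1}, k₂ < 2^{i₂+1}} θθ·a(k)`.
[folklore] -/
theorem tsum_dyadicBox_eq_sum (a : ℕ × ℕ → ℂ) (i : ℕ × ℕ) :
    ∑' k : ℕ × ℕ, ((dyadicBump ((k.1 : ℝ) / 2 ^ i.1) * dyadicBump ((k.2 : ℝ) / 2 ^ i.2) : ℝ) : ℂ) * a k =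
      ∑ k ∈ Finset.range (2 ^ (i.1 + 1)) ×ˢ Finset.range (2 ^ (i.2 + 1)),
        ((dyadicBump ((k.1 : ℝ) / 2 ^ i.1) * dyadicBump ((k.2 : ℝ) / 2 ^ i.2) : ℝ) : ℂ) * a k :=
  tsum_eq_sum fun k hk ↦ by rw [dyadicWeight_eq_zero_of_not_mem_box hk, Complex.ofReal_zero, zero_mul]

/-- The weighted family `(k, i) ↦ θ(k₁/2^{i₁})θ(k₂/2^{i₂})·a(k)` (fibred over `k` first) is absolutely
summable on `(ℕ×ℕ) × (ℕ×ℕ)` when `a` is. [folklore] -/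
theorem summable_dyadicWeight_mul_fiber {a : ℕ × ℕ → ℂ} (ha : Summable a) :
    Summable (fun p : (ℕ × ℕ) × (ℕ × ℕ) ↦
      ((dyadicBump ((p.1.1 : ℝ) / 2 ^ p.2.1) * dyadicBump ((p.1.2 : ℝ) / 2 ^ p.2.2) : ℝ) : ℂ) * a p.1) := by
  -- the nonnegative real majorant `G (k, i) = θθ · ‖a k‖`
  have hG0 : ∀ p : (ℕ × ℕ) × (ℕ × ℕ),
      0 ≤ dyadicBump ((p.1.1 : ℝ) / 2 ^ p.2.1) * dyadicBump ((p.1.2 : ℝ) / 2 ^ p.2.2) * ‖a p.1‖ :=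
    fun p ↦ mul_nonneg (dyadicWeight_mem_Icc p.2 p.1).1 (norm_nonneg _)
  have hfib : ∀ k : ℕ × ℕ, HasSum (fun i : ℕ × ℕ ↦
      dyadicBump ((k.1 : ℝ) / 2 ^ i.1) * dyadicBump ((k.2 : ℝ) / 2 ^ i.2) * ‖a k‖)
      ((if k.1 = 0 ∨ k.2 = 0 then (0 : ℝ) else 1) * ‖a k‖) :=
    fun k ↦ (hasSum_dyadicWeight k).mul_right _
  have hreal : Summable (fun p : (ℕ × ℕ) × (ℕ × ℕ) ↦
      dyadicBump ((p.1.1 : ℝ) / 2 ^ p.2.1) * dyadicBump ((p.1.2 : ℝ) / 2 ^ p.2.2) * ‖a p.1‖) := by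
    refine (summable_prod_of_nonneg fun p ↦ hG0 p).mpr ⟨fun k ↦ (hfib k).summable, ?_⟩
    have heq : (fun k : ℕ × ℕ ↦ ∑' i : ℕ × ℕ,
        dyadicBump ((k.1 : ℝ) / 2 ^ i.1) * dyadicBump ((k.2 : ℝ) / 2 ^ i.2) * ‖a k‖) =
        fun k ↦ (if k.1 = 0 ∨ k.2 = 0 then (0 : ℝ) else 1) * ‖a k‖ :=
      funext fun k ↦ (hfib k).tsum_eq
    rw [heq]
    refine Summable.of_nonneg_of_le (fun k ↦ ?_) (fun k ↦ ?_) ha.norm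
    · split_ifs
      · rw [zero_mul]
      · rw [one_mul]; exact norm_nonneg _
    · split_ifs
      · rw [zero_mul]; exact norm_nonneg _
      · rw [one_mul]
  refine Summable.of_norm_bounded hreal fun p ↦ le_of_eq ?_
  rw [norm_mul, Complex.norm_real, Real.norm_of_nonneg (dyadicWeight_mem_Icc p.2 p.1).1]

/-- The same family fibred over the BOX first: `(i, k) ↦ θ(k₁/2^{i₁})θ(k₂/2^{i₂})·a(k)` is absolutely
summable (the uncurried form `Summable.tsum_comm` / `Summable.prod` consume). [folklore] -/
theorem summable_dyadicWeight_mul {a : ℕ × ℕ → ℂ} (ha : Summable a) :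
    Summable (Function.uncurry fun (i k : ℕ × ℕ) ↦
      ((dyadicBump ((k.1 : ℝ) / 2 ^ i.1) * dyadicBump ((k.2 : ℝ) / 2 ^ i.2) : ℝ) : ℂ) * a k) := by
  have h := (summable_dyadicWeight_mul_fiber ha).prod_symm
  refine h.congr fun p ↦ ?_
  rfl

/-- **The outer box series converges absolutely.** [folklore] -/
theorem summable_dyadicBoxes {a : ℕ × ℕ → ℂ} (ha : Summable a) :
    Summable (fun i : ℕ × ℕ ↦ ∑' k : ℕ × ℕ,
      ((dyadicBump ((k.1 : ℝ) / 2 ^ i.1) * dyadicBump ((k.2 : ℝ) / 2 ^ i.2) : ℝ) : ℂ) * a k) :=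
  (summable_dyadicWeight_mul ha).prod

/-- **Insertion of the dyadic partition**: for `a : ℕ × ℕ → ℂ` absolutely convergent and vanishing on the
axes (`k₁ = 0` or `k₂ = 0`), `Σ_k a(k) = Σ_{i ∈ ℕ²} Σ_k θ(k₁/2^{i₁})θ(k₂/2^{i₂})·a(k)` (GATE G2 §(a) a5:
the `(n₁,n₂)`-sum cut into dyadic boxes with smooth weights). [folklore] -/
theorem tsum_eq_tsum_dyadicBoxes {a : ℕ × ℕ → ℂ} (ha : Summable a)
    (h0 : ∀ k : ℕ × ℕ, k.1 = 0 ∨ k.2 = 0 → a k = 0) :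
    ∑' k : ℕ × ℕ, a k = ∑' i : ℕ × ℕ, ∑' k : ℕ × ℕ,
      ((dyadicBump ((k.1 : ℝ) / 2 ^ i.1) * dyadicBump ((k.2 : ℝ) / 2 ^ i.2) : ℝ) : ℂ) * a k := by
  -- `a k = Σ'_i θθ a k` for every `k`
  have hk : ∀ k : ℕ × ℕ, a k = ∑' i : ℕ × ℕ,
      ((dyadicBump ((k.1 : ℝ) / 2 ^ i.1) * dyadicBump ((k.2 : ℝ) / 2 ^ i.2) : ℝ) : ℂ) * a k := by
    intro k
    rw [tsum_mul_right, ← Complex.ofReal_tsum, (hasSum_dyadicWeight k).tsum_eq]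
    by_cases h : k.1 = 0 ∨ k.2 = 0
    · rw [if_pos h, h0 k h, mul_zero]
    · rw [if_neg h, Complex.ofReal_one, one_mul]
  calc ∑' k : ℕ × ℕ, a k
      = ∑' k : ℕ × ℕ, ∑' i : ℕ × ℕ,
          ((dyadicBump ((k.1 : ℝ) / 2 ^ i.1) * dyadicBump ((k.2 : ℝ) / 2 ^ i.2) : ℝ) : ℂ) * a k :=
        tsum_congr hk
    _ = _ := (summable_dyadicWeight_mul ha).tsum_comm

/-! ### §3 Smooth compactly supported box weights `Φ = θ(y₁/K₁)θ(y₂/K₂)·g` -/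

/-- The two-dimensional bump `(y₁,y₂) ↦ θ(y₁/K₁)θ(y₂/K₂)` is smooth on `ℝ²`. [folklore] -/
theorem contDiff_dyadicBump₂ (K₁ K₂ : ℝ) :
    ContDiff ℝ ∞ (fun y : ℝ × ℝ ↦ dyadicBump (y.1 / K₁) * dyadicBump (y.2 / K₂)) :=
  (contDiff_dyadicBump.comp (contDiff_fst.div_const K₁)).mul
    (contDiff_dyadicBump.comp (contDiff_snd.div_const K₂))

/-- Support of the two-dimensional bump: if `θ(y₁/K₁)θ(y₂/K₂) ≠ 0` (`K_j > 0`) then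
`K_j/2 < y_j < 2K_j`. [folklore] -/
theorem mem_box_of_dyadicBump₂_ne_zero {K₁ K₂ : ℝ} (hK₁ : 0 < K₁) (hK₂ : 0 < K₂) {y : ℝ × ℝ}
    (h : dyadicBump (y.1 / K₁) * dyadicBump (y.2 / K₂) ≠ 0) :
    (K₁ / 2 < y.1 ∧ y.1 < 2 * K₁) ∧ (K₂ / 2 < y.2 ∧ y.2 < 2 * K₂) := by
  obtain ⟨h1, h2⟩ := mul_ne_zero_iff.mp h
  have m1 := mem_Ioo_of_dyadicBump_ne_zero h1
  have m2 := mem_Ioo_of_dyadicBump_ne_zero h2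
  rw [Set.mem_Ioo, lt_div_iff₀ hK₁, div_lt_iff₀ hK₁] at m1
  rw [Set.mem_Ioo, lt_div_iff₀ hK₂, div_lt_iff₀ hK₂] at m2
  constructor <;> constructor <;> linarith

/-- Off the open quadrant the box weight vanishes near every point: if `y₁ ≤ 0` or `y₂ ≤ 0` then
`θ(·/K₁)θ(·/K₂)·g = 0` on a neighbourhood of `y` (`K_j > 0`). [folklore] -/
theorem dyadicBox_mul_eventuallyEq_zero {K₁ K₂ : ℝ} (hK₁ : 0 < K₁) (hK₂ : 0 < K₂) (g : ℝ × ℝ → ℂ)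
    {y : ℝ × ℝ} (hy : y ∉ Set.Ioi (0 : ℝ) ×ˢ Set.Ioi (0 : ℝ)) :
    (fun z : ℝ × ℝ ↦ ((dyadicBump (z.1 / K₁) * dyadicBump (z.2 / K₂) : ℝ) : ℂ) * g z) =ᶠ[𝓝 y]
      fun _ ↦ 0 := by
  rw [Set.mem_prod, Set.mem_Ioi, Set.mem_Ioi, not_and_or, not_lt, not_lt] at hy
  rcases hy with hy | hy
  · have hopen : IsOpen {z : ℝ × ℝ | z.1 < K₁ / 2} := isOpen_lt continuous_fst continuous_const
    filter_upwards [hopen.mem_nhds (show y.1 < K₁ / 2 by linarith)] with z hz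
    have : dyadicBump (z.1 / K₁) = 0 :=
      dyadicBump_of_le_half (by rw [div_le_iff₀ hK₁]; linarith [hz.le])
    simp [this]
  · have hopen : IsOpen {z : ℝ × ℝ | z.2 < K₂ / 2} := isOpen_lt continuous_snd continuous_const
    filter_upwards [hopen.mem_nhds (show y.2 < K₂ / 2 by linarith)] with z hz
    have : dyadicBump (z.2 / K₂) = 0 :=
      dyadicBump_of_le_half (by rw [div_le_iff₀ hK₂]; linarith [hz.le])
    simp [this]

/-- **The box weight is `C^∞` on all of `ℝ²`**: for `g` smooth on the open quadrant `(0,∞)²` and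
`K₁, K₂ > 0`, `Φ(y) = θ(y₁/K₁)θ(y₂/K₂)·g(y)` is `C^∞` (inside the quadrant a product of smooth functions,
outside it identically `0` near every point). [folklore] -/
theorem contDiff_dyadicBox_mul {K₁ K₂ : ℝ} (hK₁ : 0 < K₁) (hK₂ : 0 < K₂) {g : ℝ × ℝ → ℂ}
    (hg : ContDiffOn ℝ ∞ g (Set.Ioi (0 : ℝ) ×ˢ Set.Ioi (0 : ℝ))) :
    ContDiff ℝ ∞ (fun y : ℝ × ℝ ↦ ((dyadicBump (y.1 / K₁) * dyadicBump (y.2 / K₂) : ℝ) : ℂ) * g y) := by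
  have hQ : IsOpen (Set.Ioi (0 : ℝ) ×ˢ Set.Ioi (0 : ℝ)) := isOpen_Ioi.prod isOpen_Ioi
  have hθ : ContDiff ℝ ∞ (fun y : ℝ × ℝ ↦ ((dyadicBump (y.1 / K₁) * dyadicBump (y.2 / K₂) : ℝ) : ℂ)) :=
    Complex.ofRealCLM.contDiff.comp (contDiff_dyadicBump₂ K₁ K₂)
  refine contDiff_iff_contDiffAt.mpr fun y ↦ ?_
  by_cases hy : y ∈ Set.Ioi (0 : ℝ) ×ˢ Set.Ioi (0 : ℝ)
  · exact hθ.contDiffAt.mul (hg.contDiffAt (hQ.mem_nhds hy))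
  · exact (contDiffAt_const (c := (0 : ℂ))).congr_of_eventuallyEq
      (dyadicBox_mul_eventuallyEq_zero hK₁ hK₂ g hy)

/-- **The box weight has compact support**, contained in `[K₁/2, 2K₁] × [K₂/2, 2K₂]`. [folklore] -/
theorem hasCompactSupport_dyadicBox_mul {K₁ K₂ : ℝ} (hK₁ : 0 < K₁) (hK₂ : 0 < K₂) (g : ℝ × ℝ → ℂ) :
    HasCompactSupport (fun y : ℝ × ℝ ↦ ((dyadicBump (y.1 / K₁) * dyadicBump (y.2 / K₂) : ℝ) : ℂ) * g y) := by
  refine HasCompactSupport.of_support_subset_isCompact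
    ((isCompact_Icc (a := K₁ / 2) (b := 2 * K₁)).prod (isCompact_Icc (a := K₂ / 2) (b := 2 * K₂))) ?_
  intro y hy
  rw [Function.mem_support] at hy
  have hθ : dyadicBump (y.1 / K₁) * dyadicBump (y.2 / K₂) ≠ 0 := by
    intro h; exact hy (by rw [h, Complex.ofReal_zero, zero_mul])
  obtain ⟨⟨a1, a2⟩, ⟨b1, b2⟩⟩ := mem_box_of_dyadicBump₂_ne_zero hK₁ hK₂ hθ
  exact ⟨⟨a1.le, a2.le⟩, ⟨b1.le, b2.le⟩⟩

/-- The support of the box weight lies in the OPEN quadrant (so Poisson data never meet the axes).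
[folklore] -/
theorem support_dyadicBox_mul_subset {K₁ K₂ : ℝ} (hK₁ : 0 < K₁) (hK₂ : 0 < K₂) (g : ℝ × ℝ → ℂ) :
    Function.support (fun y : ℝ × ℝ ↦ ((dyadicBump (y.1 / K₁) * dyadicBump (y.2 / K₂) : ℝ) : ℂ) * g y) ⊆
      Set.Ioi (0 : ℝ) ×ˢ Set.Ioi (0 : ℝ) := by
  intro y hy
  rw [Function.mem_support] at hy
  have hθ : dyadicBump (y.1 / K₁) * dyadicBump (y.2 / K₂) ≠ 0 := by
    intro h; exact hy (by rw [h, Complex.ofReal_zero, zero_mul])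
  obtain ⟨⟨a1, -⟩, ⟨b1, -⟩⟩ := mem_box_of_dyadicBump₂_ne_zero hK₁ hK₂ hθ
  exact ⟨lt_trans (by positivity) a1, lt_trans (by positivity) b1⟩

/-- The curried form used by `FriedlanderIwaniecPrimes.tsum_tsum_arithProg₂` (`Φ : ℝ → ℝ → ℂ`): its
uncurry is the box weight, hence smooth with compact support. [folklore] -/
theorem contDiff_uncurry_dyadicBox_mul {K₁ K₂ : ℝ} (hK₁ : 0 < K₁) (hK₂ : 0 < K₂) {g : ℝ × ℝ → ℂ}
    (hg : ContDiffOn ℝ ∞ g (Set.Ioi (0 : ℝ) ×ˢ Set.Ioi (0 : ℝ))) :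
    ContDiff ℝ ∞ (Function.uncurry fun y₁ y₂ : ℝ ↦
        ((dyadicBump (y₁ / K₁) * dyadicBump (y₂ / K₂) : ℝ) : ℂ) * g (y₁, y₂)) ∧
      HasCompactSupport (Function.uncurry fun y₁ y₂ : ℝ ↦
        ((dyadicBump (y₁ / K₁) * dyadicBump (y₂ / K₂) : ℝ) : ℂ) * g (y₁, y₂)) :=
  ⟨contDiff_dyadicBox_mul hK₁ hK₂ hg, hasCompactSupport_dyadicBox_mul hK₁ hK₂ g⟩

end Summit.Parity.GeneralizedHardyLittlewood.Theorems.BeyondDiagonalBeatsQuarter.OffDiag
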